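import Summits.RiemannHypothesis.RiemannHypothesis.Theorems.WeilColumnThetaMajorantE1
import Summits.RiemannHypothesis.RiemannHypothesis.Theorems.WeilColumnThetaCutWitness
import Summits.RiemannHypothesis.RiemannHypothesis.Theorems.WeilColumnTruncatedWitness
import Summits.RiemannHypothesis.RiemannHypothesis.Theorems.WeilColumnThetaTailNorms
import Summits.RiemannHypothesis.RiemannHypothesis.Theorems.WeilColumnBSplineIrwinHall
import HarnessLib

/-!
# E2: the tier-2 CELL ENVELOPES of the cut theta tail `T` and of `T′` at depth `t` below the cut (RH-FREE)

WEIL column (LADDER-RH, W-P(P2); route `WeilSemilocal`, tier-2 twin residue, item 19172; cc-s2-1 gen22 TIER2-KERNEL-SPEC §2 (E2) / §5 (K1),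
THETA-CERT-cc6 §E2). With `x = x₁ − t` (`t ≥ 0` the depth below the cut point `x₁ = η − a`, `eˣ = u₁e^{−t}`), E1
(`WeilColumnThetaMajorantE1`) turns into the envelopes the kernel's cells enclose:

* §1 the cut factor at depth `t`: `1 − χ(x₁ − t) = bsplineCDF (η/(2m)) (m−1) (t − η/2) = irwinHall m (m t/η)` (monotone in `t`,
  `∈ [0,1]`, `= 0` for `t ≤ 0`), so on the depth cell `t ≤ (j+1)τ`: `1 − χ(x₁ − t) ≤ irwinHall m (m(j+1)τ/η)` (= the kernel's `c_j`);
  `χ′(x₁ − t) = ρ(η/2 − t)` vanishes for `t ≥ η` and `|χ′| ≤ m/η`;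
* §2 **E2a** `norm_T_depth_le_sine : ‖T(x₁ − t)‖ ≤ √u₁·M₀·e^{−(m+½)t}·S(t)·(1 − χ(x₁ − t))`,
  **E2b** `norm_deriv_T_depth_le_sine : ‖T′(x₁ − t)‖ ≤ √u₁·e^{−t/2}·[(½M₀e^{−mt}S(t) + M₁₀e^{−(m−1)t}S₁(t))·(1 − χ(x₁ − t)) + M₀e^{−mt}S(t)·|χ′(x₁ − t)|]`
  (`S`, `S₁` = `ThetaTier2.Sfun/S1fun` unfolded, any `K`, any residues `R`, `Rm`) — i.e. `e(t)`, `e′(t)` of THETA-CERT-cc6 §E2 times `√u₁`;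
* §3 the truncated tail is dominated pointwise, `‖T_R x‖ ≤ ‖T x‖`, and the NORMALISED envelope `tailEnv P t := ‖T(x₁ − t)‖/(√u₁M₀)`
  (continuous, `≥ 0`, `= 0` for `t ≤ 0`, `≤ ζ(m+1)e^{−(m+½)t}` for `t ≥ 0`, `≤ e^{−(m+½)t}S(t)(1 − χ(x₁−t))`) — the `e` of E3-core/E4-core.
Nothing here bears on the truth of RH.
-/

set_option linter.dupNamespace false

noncomputable section

open MeasureTheory Set Complex Filter Finset
open scoped Real
open Literature.NumberTheory.LFunctions

namespace Summit.RiemannHypothesis.RiemannHypothesis.Theorems.WeilColumn.ThetaMellin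

namespace ThetaParams

variable (P : ThetaParams)

/-! ## §1 The cut and its derivative at depth `t` -/

/-- `1 − χ(x₁ − t) = F_{η/(2m), m−1}(t − η/2)` (symmetry of the B-spline CDF). [this seat; THETA-CERT-cc6 §E2] -/
theorem one_sub_cut_depth_eq (hη : 0 < P.η) (hm : 1 ≤ P.m) (t : ℝ) :
    1 - P.cut (P.x₁ - t) = bsplineCDF (P.η / (2 * P.m)) (P.m - 1) (t - P.η / 2) := by
  unfold cut
  have e : P.x₁ - t + P.a - P.η / 2 = -(t - P.η / 2) := by unfold x₁; ring
  rw [e, bsplineCDF_neg (P.cut_scale_pos hη hm)]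
  ring

/-- **`1 − χ(x₁ − t) = irwinHall m (m t/η)`** (the Irwin–Hall CDF of the depth in cut units). [this seat; TIER2-KERNEL-SPEC §1 (`cList`)] -/
theorem one_sub_cut_depth_eq_irwinHall (hη : 0 < P.η) (hm : 1 ≤ P.m) (t : ℝ) :
    1 - P.cut (P.x₁ - t) = irwinHall P.m (P.m * t / P.η) := by
  rw [P.one_sub_cut_depth_eq hη hm, bsplineCDF_eq_irwinHall (P.cut_scale_pos hη hm), Nat.sub_add_cancel hm]
  congr 1
  have hm0 : (0 : ℝ) < P.m := Nat.cast_pos.2 (by omega)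
  have e : (((P.m - 1 : ℕ) : ℝ) + 1) = P.m := by rw [Nat.cast_sub hm]; push_cast; ring
  rw [e]
  field_simp
  ring

/-- `t ↦ 1 − χ(x₁ − t)` is monotone. [folklore] -/
theorem one_sub_cut_depth_mono (hη : 0 < P.η) (hm : 1 ≤ P.m) : Monotone fun t : ℝ ↦ 1 - P.cut (P.x₁ - t) := by
  intro s t hst
  have := P.cut_mono hη hm (show P.x₁ - t ≤ P.x₁ - s by linarith)
  simp only
  linarith

/-- `1 − χ(x₁ − t) ∈ [0, 1]`. [folklore] -/
theorem one_sub_cut_depth_mem_Icc (hη : 0 < P.η) (hm : 1 ≤ P.m) (t : ℝ) : 1 - P.cut (P.x₁ - t) ∈ Icc (0 : ℝ) 1 := by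
  have h := P.cut_mem_Icc hη hm (P.x₁ - t)
  exact ⟨by linarith [h.2], by linarith [h.1]⟩

/-- Above the cut (`t ≤ 0`): `1 − χ(x₁ − t) = 0`. [folklore] -/
theorem one_sub_cut_depth_eq_zero (hη : 0 < P.η) (hm : 1 ≤ P.m) {t : ℝ} (ht : t ≤ 0) : 1 - P.cut (P.x₁ - t) = 0 := by
  rw [P.cut_eq_one hη hm (by linarith)]; ring

/-- **The cut factor on a depth cell**: for `t ≤ b`, `1 − χ(x₁ − t) ≤ irwinHall m (m b/η)` (`b = (j+1)τ`: the kernel's `c_j`). [TIER2-KERNEL-SPEC §1/§5 (K1)] -/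
theorem one_sub_cut_depth_le_irwinHall (hη : 0 < P.η) (hm : 1 ≤ P.m) {t b : ℝ} (htb : t ≤ b) :
    1 - P.cut (P.x₁ - t) ≤ irwinHall P.m (P.m * b / P.η) := by
  have h := P.one_sub_cut_depth_mono hη hm htb
  simp only at h
  rwa [P.one_sub_cut_depth_eq_irwinHall hη hm b] at h

/-- The argument of `χ′` at depth `t`: `(x₁ − t) + a − η/2 = η/2 − t`. [folklore] -/
theorem cut_deriv_arg (t : ℝ) : P.x₁ - t + P.a - P.η / 2 = P.η / 2 - t := by unfold x₁; ring

/-- **`χ′(x₁ − t) = 0` for `t ≥ η`** (the B-spline density of order `m − 1 ≥ 1` is continuous and vanishes off `(−η/2, η/2)`). [folklore] -/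
theorem cut_deriv_depth_eq_zero (hη : 0 < P.η) (hm : 2 ≤ P.m) {t : ℝ} (ht : P.η ≤ t) :
    (bsplineDensity (P.η / (2 * P.m)) (P.m - 1) (P.x₁ - t + P.a - P.η / 2)).re = 0 := by
  have hc := P.cut_scale_pos hη (by omega)
  have hm0 : (0 : ℝ) < P.m := Nat.cast_pos.2 (by omega)
  have hw : (((P.m - 1 : ℕ) : ℝ) + 1) * (P.η / (2 * P.m)) = P.η / 2 := by
    rw [Nat.cast_sub (by omega : 1 ≤ P.m)]; push_cast; field_simp; ring
  rw [P.cut_deriv_arg]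
  -- the zero set of the continuous density is closed and contains `(−∞, −η/2)`, hence `−η/2 − (t − η)` for all `t ≥ η`
  have hcont := continuous_bsplineDensity_re hc (k := P.m - 1) (by omega)
  have hzero : ∀ v : ℝ, v < -(P.η / 2) → (bsplineDensity (P.η / (2 * P.m)) (P.m - 1) v).re = 0 := fun v hv ↦
    bsplineDensity_re_eq_zero hc.le _ (fun hmem ↦ by rw [hw] at hmem; linarith [hmem.1])
  have hclosed : IsClosed {v : ℝ | (bsplineDensity (P.η / (2 * P.m)) (P.m - 1) v).re = 0} := isClosed_eq hcont continuous_const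
  have hsub : closure (Iio (-(P.η / 2))) ⊆ {v : ℝ | (bsplineDensity (P.η / (2 * P.m)) (P.m - 1) v).re = 0} :=
    hclosed.closure_subset_iff.2 fun v hv ↦ hzero v hv
  rw [closure_Iio] at hsub
  exact hsub (show P.η / 2 - t ∈ Set.Iic (-(P.η / 2)) by rw [Set.mem_Iic]; linarith)

/-- `|χ′(x₁ − t)| ≤ m/η`. [folklore] -/
theorem abs_cut_deriv_depth_le (hη : 0 < P.η) (hm : 2 ≤ P.m) (t : ℝ) :
    |(bsplineDensity (P.η / (2 * P.m)) (P.m - 1) (P.x₁ - t + P.a - P.η / 2)).re| ≤ P.m / P.η :=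
  P.abs_cut_deriv_le hη hm _

/-! ## §2 E2: the envelopes of `T` and `T′` at depth `t` -/

/-- `e^{x₁ − t} = u₁e^{−t}`. [folklore] -/
theorem exp_depth (t : ℝ) : Real.exp (P.x₁ - t) = P.u₁ * Real.exp (-t) := by
  unfold u₁; rw [← Real.exp_add]; ring_nf

/-- `e^{(x₁ − t)/2} = √u₁·e^{−t/2}`. [folklore] -/
theorem exp_half_depth (t : ℝ) : Real.exp ((P.x₁ - t) / 2) = Real.sqrt P.u₁ * Real.exp (-(1 / 2 : ℝ) * t) := by
  unfold u₁; rw [← Real.exp_half, ← Real.exp_add]; ring_nf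

/-- `0 < M₀` for an admissible row (`Σ|cᵢ| = 2 + 2α ≥ 2`). [folklore] -/
theorem M₀_pos {qn : ℕ} (hP : P.Admissible qn) : 0 < P.M₀ := by
  obtain ⟨-, -, hz, -, hα, -, -⟩ := P.e1_pos hP
  have hm' : (0 : ℝ) < P.m := by exact_mod_cast (le_trans (by norm_num) hP.three_le : 1 ≤ P.m)
  have hcs : 0 < P.csum := by unfold csum; linarith
  unfold M₀; positivity

/-- **E2a — the envelope of `T` at depth `t` with the sines kept**: for every `K`, `t` and residue `R ≥ ζ(m+1) − Σ_{k≤K}k^{−(m+1)}`,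
`‖T(x₁ − t)‖ ≤ √u₁·M₀·e^{−(m+½)t}·S(t)·(1 − χ(x₁ − t))`, `S(t) = Σ_{k≤K}|sin(kθ₀eᵗ)|^m/k^{m+1} + R`. [THETA-CERT-cc6 §E2; TIER2-KERNEL-SPEC §2/§5 (K1)] -/
theorem norm_T_depth_le_sine {qn : ℕ} (hP : P.Admissible qn) (K : ℕ) (t : ℝ) {R : ℝ}
    (hR : zetaTail (P.m + 1) - ∑ k ∈ Ico 1 (K + 1), 1 / (k : ℝ) ^ (P.m + 1) ≤ R) :
    ‖P.T (P.x₁ - t)‖ ≤ Real.sqrt P.u₁ * P.M₀ * (Real.exp (-(P.m + 1 / 2 : ℝ) * t) *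
        ((∑ k ∈ Ico 1 (K + 1), |Real.sin (k * (P.θ₀ * Real.exp t))| ^ P.m / (k : ℝ) ^ (P.m + 1)) + R) *
        (1 - P.cut (P.x₁ - t))) := by
  have hm : 1 ≤ P.m := le_trans (by norm_num) hP.three_le
  have hc := (P.one_sub_cut_depth_mem_Icc hP.eta_pos hm t).1
  have hT : P.T (P.x₁ - t) =
      (Real.exp ((P.x₁ - t) / 2) : ℂ) * P.Θ (Real.exp (P.x₁ - t)) * ((1 - P.cut (P.x₁ - t) : ℝ) : ℂ) := rfl
  rw [hT, norm_mul, norm_mul, Complex.norm_real, Complex.norm_real, Real.norm_of_nonneg (Real.exp_pos _).le,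
    Real.norm_of_nonneg hc, P.exp_half_depth, P.exp_depth]
  have hE1 := P.norm_Θ_exp_le_sine hP K t hR
  have hpre : 0 ≤ Real.sqrt P.u₁ * Real.exp (-(1 / 2 : ℝ) * t) := by positivity
  calc Real.sqrt P.u₁ * Real.exp (-(1 / 2 : ℝ) * t) * ‖P.Θ (P.u₁ * Real.exp (-t))‖ * (1 - P.cut (P.x₁ - t))
      ≤ Real.sqrt P.u₁ * Real.exp (-(1 / 2 : ℝ) * t) * (P.M₀ * Real.exp (-(P.m : ℝ) * t) *
          ((∑ k ∈ Ico 1 (K + 1), |Real.sin (k * (P.θ₀ * Real.exp t))| ^ P.m / (k : ℝ) ^ (P.m + 1)) + R)) *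
          (1 - P.cut (P.x₁ - t)) :=
        mul_le_mul_of_nonneg_right (mul_le_mul_of_nonneg_left hE1 hpre) hc
    _ = _ := by
        have e : Real.exp (-(P.m + 1 / 2 : ℝ) * t) = Real.exp (-(1 / 2 : ℝ) * t) * Real.exp (-(P.m : ℝ) * t) := by
          rw [← Real.exp_add]; congr 1; ring
        rw [e]; ring

/-- **The derivative of `T`** (tier-1 `ThetaTail.hasDerivAt_tail` at the witness):
`T′(x) = e^{x/2}(½Θ(eˣ) + eˣΘ′(eˣ))(1 − χ(x)) − e^{x/2}Θ(eˣ)χ′(x)`. [folklore] -/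
theorem hasDerivAt_T {qn : ℕ} (hP : P.Admissible qn) (x : ℝ) :
    HasDerivAt P.T
      ((Real.exp (x / 2) : ℂ) * ((1 / 2 : ℂ) * P.Θ (Real.exp x) + (Real.exp x : ℂ) * deriv P.Θ (Real.exp x)) *
          (((1 - P.cut x : ℝ)) : ℂ) -
        (Real.exp (x / 2) : ℂ) * P.Θ (Real.exp x) *
          ((bsplineDensity (P.η / (2 * P.m)) (P.m - 1) (x + P.a - P.η / 2)).re : ℂ)) x := by
  have hm2 : 2 ≤ P.m := le_trans (by norm_num) hP.three_le
  have hT : P.T = fun x ↦ expProfile P.Θ x * (((1 - P.cut x : ℝ)) : ℂ) := rfl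
  rw [hT]
  exact ThetaTail.hasDerivAt_tail (Θ := P.Θ) (Θ' := deriv P.Θ) (χ := P.cut)
    (χ' := fun x ↦ (bsplineDensity (P.η / (2 * P.m)) (P.m - 1) (x + P.a - P.η / 2)).re)
    (fun u hu ↦ P.hasDerivAt_deriv_Θ hP hu) (fun x ↦ P.hasDerivAt_cut hP.eta_pos hm2 x) x

/-- **E2b — the envelope of `T′` at depth `t` with the sines kept**: for every `K`, `t`, residues `R`, `Rm`,
`‖T′(x₁ − t)‖ ≤ √u₁·e^{−t/2}·[(½M₀e^{−mt}S(t) + M₁₀e^{−(m−1)t}S₁(t))·(1 − χ(x₁ − t)) + M₀e^{−mt}S(t)·|χ′(x₁ − t)|]`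
(the bracket is the left side of cc-s2-1's `cellStep_ep` with `cb := 1 − χ(x₁ − t)`, `cpb := |χ′(x₁ − t)|`). [THETA-CERT-cc6 §E2; TIER2-KERNEL-SPEC §2/§5 (K1)] -/
theorem norm_deriv_T_depth_le_sine {qn : ℕ} (hP : P.Admissible qn) (K : ℕ) (t : ℝ) {R Rm : ℝ}
    (hR : zetaTail (P.m + 1) - ∑ k ∈ Ico 1 (K + 1), 1 / (k : ℝ) ^ (P.m + 1) ≤ R)
    (hRm : zetaTail P.m - ∑ k ∈ Ico 1 (K + 1), 1 / (k : ℝ) ^ P.m ≤ Rm) :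
    ‖deriv P.T (P.x₁ - t)‖ ≤ Real.sqrt P.u₁ * (Real.exp (-(1 / 2 : ℝ) * t) *
      ((P.M₀ / 2 * Real.exp (-(P.m : ℝ) * t) *
            ((∑ k ∈ Ico 1 (K + 1), |Real.sin (k * (P.θ₀ * Real.exp t))| ^ P.m / (k : ℝ) ^ (P.m + 1)) + R) +
          P.M₁₀ * Real.exp (-(P.m - 1 : ℝ) * t) *
            ((∑ k ∈ Ico 1 (K + 1), (P.c₂ * |Real.sin (k * (P.θ₀ * Real.exp t))| ^ P.m +
                P.ε * |Real.sin (k * (P.θ₀ * Real.exp t))| ^ (P.m - 1) * (1 + (P.θ₀ * Real.exp t)⁻¹ / k)) / (k : ℝ) ^ P.m)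
              + Rm * (P.c₂ + P.ε * (1 + (P.θ₀ * Real.exp t)⁻¹ / (K + 1))))) *
          (1 - P.cut (P.x₁ - t)) +
        P.M₀ * Real.exp (-(P.m : ℝ) * t) *
            ((∑ k ∈ Ico 1 (K + 1), |Real.sin (k * (P.θ₀ * Real.exp t))| ^ P.m / (k : ℝ) ^ (P.m + 1)) + R) *
          |(bsplineDensity (P.η / (2 * P.m)) (P.m - 1) (P.x₁ - t + P.a - P.η / 2)).re|)) := by
  have hm : 1 ≤ P.m := le_trans (by norm_num) hP.three_le
  have hc := (P.one_sub_cut_depth_mem_Icc hP.eta_pos hm t).1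
  rw [(P.hasDerivAt_T hP (P.x₁ - t)).deriv]
  -- abbreviations
  set S : ℝ := (∑ k ∈ Ico 1 (K + 1), |Real.sin (k * (P.θ₀ * Real.exp t))| ^ P.m / (k : ℝ) ^ (P.m + 1)) + R with hS
  set S₁ : ℝ := (∑ k ∈ Ico 1 (K + 1), (P.c₂ * |Real.sin (k * (P.θ₀ * Real.exp t))| ^ P.m +
      P.ε * |Real.sin (k * (P.θ₀ * Real.exp t))| ^ (P.m - 1) * (1 + (P.θ₀ * Real.exp t)⁻¹ / k)) / (k : ℝ) ^ P.m)
      + Rm * (P.c₂ + P.ε * (1 + (P.θ₀ * Real.exp t)⁻¹ / (K + 1))) with hS₁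
  set c : ℝ := 1 - P.cut (P.x₁ - t) with hcdef
  set d : ℝ := (bsplineDensity (P.η / (2 * P.m)) (P.m - 1) (P.x₁ - t + P.a - P.η / 2)).re with hd
  -- the two E1 bounds at `u = u₁e^{−t} = e^{x₁ − t}`
  have hE1 : ‖P.Θ (Real.exp (P.x₁ - t))‖ ≤ P.M₀ * Real.exp (-(P.m : ℝ) * t) * S := by
    rw [P.exp_depth]; exact P.norm_Θ_exp_le_sine hP K t hR
  have hE1' : ‖(Real.exp (P.x₁ - t) : ℂ) * deriv P.Θ (Real.exp (P.x₁ - t))‖ ≤ P.M₁₀ * Real.exp (-(P.m - 1 : ℝ) * t) * S₁ := by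
    rw [P.exp_depth]; exact P.norm_mul_deriv_Θ_exp_le_sine hP K t hRm
  have hA : ‖(Real.exp ((P.x₁ - t) / 2) : ℂ)‖ = Real.sqrt P.u₁ * Real.exp (-(1 / 2 : ℝ) * t) := by
    rw [Complex.norm_real, Real.norm_of_nonneg (Real.exp_pos _).le, P.exp_half_depth]
  have hB : ‖(1 / 2 : ℂ) * P.Θ (Real.exp (P.x₁ - t)) + (Real.exp (P.x₁ - t) : ℂ) * deriv P.Θ (Real.exp (P.x₁ - t))‖ ≤
      P.M₀ / 2 * Real.exp (-(P.m : ℝ) * t) * S + P.M₁₀ * Real.exp (-(P.m - 1 : ℝ) * t) * S₁ := by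
    refine (norm_add_le _ _).trans (add_le_add ?_ hE1')
    rw [norm_mul, show ‖(1 / 2 : ℂ)‖ = 1 / 2 by norm_num]
    linarith
  have hC : ‖(((1 - P.cut (P.x₁ - t) : ℝ)) : ℂ)‖ = c := by rw [Complex.norm_real, Real.norm_of_nonneg hc]
  have hD : ‖(d : ℂ)‖ = |d| := by rw [Complex.norm_real, Real.norm_eq_abs]
  have hpre : 0 ≤ Real.sqrt P.u₁ * Real.exp (-(1 / 2 : ℝ) * t) := by positivity
  have hM0S : 0 ≤ P.M₀ * Real.exp (-(P.m : ℝ) * t) * S := le_trans (norm_nonneg _) hE1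
  calc ‖(Real.exp ((P.x₁ - t) / 2) : ℂ) * ((1 / 2 : ℂ) * P.Θ (Real.exp (P.x₁ - t)) +
          (Real.exp (P.x₁ - t) : ℂ) * deriv P.Θ (Real.exp (P.x₁ - t))) * (((1 - P.cut (P.x₁ - t) : ℝ)) : ℂ) -
        (Real.exp ((P.x₁ - t) / 2) : ℂ) * P.Θ (Real.exp (P.x₁ - t)) * (d : ℂ)‖
      ≤ ‖(Real.exp ((P.x₁ - t) / 2) : ℂ)‖ * ‖(1 / 2 : ℂ) * P.Θ (Real.exp (P.x₁ - t)) +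
          (Real.exp (P.x₁ - t) : ℂ) * deriv P.Θ (Real.exp (P.x₁ - t))‖ * ‖(((1 - P.cut (P.x₁ - t) : ℝ)) : ℂ)‖ +
        ‖(Real.exp ((P.x₁ - t) / 2) : ℂ)‖ * ‖P.Θ (Real.exp (P.x₁ - t))‖ * ‖(d : ℂ)‖ := by
        refine (norm_sub_le _ _).trans (le_of_eq ?_)
        rw [norm_mul, norm_mul, norm_mul, norm_mul]
    _ ≤ Real.sqrt P.u₁ * Real.exp (-(1 / 2 : ℝ) * t) * (P.M₀ / 2 * Real.exp (-(P.m : ℝ) * t) * S +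
          P.M₁₀ * Real.exp (-(P.m - 1 : ℝ) * t) * S₁) * c +
        Real.sqrt P.u₁ * Real.exp (-(1 / 2 : ℝ) * t) * (P.M₀ * Real.exp (-(P.m : ℝ) * t) * S) * |d| := by
        rw [hA, hC, hD]
        exact add_le_add (mul_le_mul_of_nonneg_right (mul_le_mul_of_nonneg_left hB hpre) hc)
          (mul_le_mul_of_nonneg_right (mul_le_mul_of_nonneg_left hE1 hpre) (abs_nonneg _))
    _ = _ := by ring

/-! ## §3 `T_R` is dominated by `T`; the normalised envelope `tailEnv` -/

/-- **`‖T_R x‖ ≤ ‖T x‖`** (`T_R = ψ_R·T`, `ψ_R ∈ [0, 1]`). [folklore] -/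
theorem norm_TR_le_norm_T (R x : ℝ) : ‖P.TR R x‖ ≤ ‖P.T x‖ := by
  have hψ := smoothStep_mem_Icc R x
  have e : P.TR R x = (smoothStep R x : ℂ) * P.T x := by
    simp only [TR, GR, T]; ring
  rw [e, norm_mul, Complex.norm_real, Real.norm_of_nonneg hψ.1]
  exact mul_le_of_le_one_left (norm_nonneg _) hψ.2

/-- **The envelope of `T` for every `u`**: `‖T u‖ ≤ M√u₁·e^{(m+½)(u−x₁)}` (D1; `= 0` above `x₁`). [THETA-CERT-cc6 §D3 (★)] -/
theorem norm_T_le {qn : ℕ} (hP : P.Admissible qn) (u : ℝ) :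
    ‖P.T u‖ ≤ P.M * Real.sqrt P.u₁ * Real.exp (((P.m : ℝ) + 1 / 2) * (u - P.x₁)) := by
  have hm : 1 ≤ P.m := le_trans (by norm_num) hP.three_le
  by_cases hu : u ≤ P.x₁
  · have hT : P.T u = expProfile P.Θ u * (((1 - P.cut u : ℝ)) : ℂ) := rfl
    rw [hT, ← ThetaTail.envelope_eq (M := P.M) (m := P.m) (rfl : P.u₁ = Real.exp P.x₁) u]
    exact ThetaTail.norm_tail_le (rfl : P.u₁ = Real.exp P.x₁) (fun v hv ↦ P.norm_Θ_le' hP hv.1)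
      (P.cut_mem_Icc hP.eta_pos hm) hu
  · rw [P.T_eq_zero_of_le hP (not_le.1 hu).le, norm_zero]
    have : 0 ≤ P.M := by
      have h := le_trans (norm_nonneg _) (P.norm_Θ_le' hP Real.zero_lt_one)
      have hc : 0 < (1 / P.u₁) ^ P.m := by have : 0 < P.u₁ := Real.exp_pos _; positivity
      exact le_of_mul_le_mul_right (by rwa [zero_mul]) hc
    positivity

/-- The NORMALISED envelope of the tail at depth `t`: `tailEnv P t := ‖T(x₁ − t)‖/(√u₁·M₀)` (the `e` of E3-core / E4-core). [this seat; THETA-CERT-cc6 §E2] -/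
def tailEnv (t : ℝ) : ℝ := ‖P.T (P.x₁ - t)‖ / (Real.sqrt P.u₁ * P.M₀)

/-- `tailEnv` is continuous. [folklore] -/
theorem continuous_tailEnv {qn : ℕ} (hP : P.Admissible qn) : Continuous P.tailEnv := by
  unfold tailEnv
  exact ((continuous_norm.comp ((P.continuous_T hP).comp (continuous_const.sub continuous_id))).div_const _)

/-- `0 ≤ tailEnv`. [folklore] -/
theorem tailEnv_nonneg {qn : ℕ} (hP : P.Admissible qn) (t : ℝ) : 0 ≤ P.tailEnv t := by
  unfold tailEnv
  exact div_nonneg (norm_nonneg _) (by have := P.M₀_pos hP; positivity)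

/-- `tailEnv t = 0` for `t ≤ 0` (above the cut). [folklore] -/
theorem tailEnv_eq_zero {qn : ℕ} (hP : P.Admissible qn) {t : ℝ} (ht : t ≤ 0) : P.tailEnv t = 0 := by
  unfold tailEnv; rw [P.T_eq_zero_of_le hP (by linarith), norm_zero, zero_div]

/-- **`‖T_R(x₁ − s)‖ ≤ (√u₁·M₀)·tailEnv s`** for every `R`, `s` (the hypothesis `hTe` of D6′). [folklore] -/
theorem norm_TR_depth_le_tailEnv {qn : ℕ} (hP : P.Admissible qn) (R s : ℝ) :
    ‖P.TR R (P.x₁ - s)‖ ≤ Real.sqrt P.u₁ * P.M₀ * P.tailEnv s := by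
  have hpos : 0 < Real.sqrt P.u₁ * P.M₀ := mul_pos (Real.sqrt_pos.2 (Real.exp_pos _)) (P.M₀_pos hP)
  unfold tailEnv
  rw [mul_div_cancel₀ _ hpos.ne']
  exact P.norm_TR_le_norm_T R _

/-- **The global exponential tail**: `tailEnv t ≤ ζ(m+1)·e^{−(m+½)t}` for every `t` (D1, `M = M₀ζ(m+1)`). [THETA-CERT-cc6 §D3/§E3] -/
theorem tailEnv_le_exp {qn : ℕ} (hP : P.Admissible qn) (t : ℝ) :
    P.tailEnv t ≤ zetaTail (P.m + 1) * Real.exp (-((P.m : ℝ) + 1 / 2) * t) := by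
  have hpos : 0 < Real.sqrt P.u₁ * P.M₀ := mul_pos (Real.sqrt_pos.2 (Real.exp_pos _)) (P.M₀_pos hP)
  unfold tailEnv
  rw [div_le_iff₀ hpos]
  refine (P.norm_T_le hP _).trans (le_of_eq ?_)
  rw [P.M_eq_M₀_mul_zetaTail]
  have e : ((P.m : ℝ) + 1 / 2) * (P.x₁ - t - P.x₁) = -((P.m : ℝ) + 1 / 2) * t := by ring
  rw [e]; ring

/-- **The cell envelope**: `tailEnv t ≤ e^{−(m+½)t}·S(t)·(1 − χ(x₁ − t))` (E2a normalised). [THETA-CERT-cc6 §E2; TIER2-KERNEL-SPEC §5 (K1)] -/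
theorem tailEnv_le_sine {qn : ℕ} (hP : P.Admissible qn) (K : ℕ) (t : ℝ) {R : ℝ}
    (hR : zetaTail (P.m + 1) - ∑ k ∈ Ico 1 (K + 1), 1 / (k : ℝ) ^ (P.m + 1) ≤ R) :
    P.tailEnv t ≤ Real.exp (-(P.m + 1 / 2 : ℝ) * t) *
        ((∑ k ∈ Ico 1 (K + 1), |Real.sin (k * (P.θ₀ * Real.exp t))| ^ P.m / (k : ℝ) ^ (P.m + 1)) + R) *
        (1 - P.cut (P.x₁ - t)) := by
  have hpos : 0 < Real.sqrt P.u₁ * P.M₀ := mul_pos (Real.sqrt_pos.2 (Real.exp_pos _)) (P.M₀_pos hP)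
  unfold tailEnv
  rw [div_le_iff₀ hpos]
  refine (P.norm_T_depth_le_sine hP K t hR).trans (le_of_eq ?_)
  ring

end ThetaParams

end Summit.RiemannHypothesis.RiemannHypothesis.Theorems.WeilColumn.ThetaMellin
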